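import Summits.QuantumFields.YangMills.Theorems.BalabanUVNodesN16Thm4AssemblyReg335
import Summits.QuantumFields.BalabanUV.T4Continuum.Spine.NE3.PairLeftChartB8
import HarnessLib

/-!
# Route «BalabanUVNodes» (cluster K4 «SpineRates»), Track-A DAG node N16 = NE3 — THE CONCL-DICTIONARY SPLIT MEMBER-WISE: of the binder (DICT)
# of files 3–4 («`Concl` ⟹ a Landau representative `(u_L, Z)` with `LandauRepB8` and the transition-gauge equation»), the members
# `unitary ∕ periodic ∕ skew ∕ per ∕ rep ∕ sup ∕ grad` and the transition-gauge equation become KERNEL from [B8] Thm 4's OUTPUT LETTERS in print's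
# left chart (n16-b's `PairLeftChartB8.endFrame_of_leftChart`), leaving `landau ∕ holder ∕ lap` on the explicit `Z := Ad_{W⁻¹}(iηA)` and the
# periodicity of Thm 4's gauge as the displayed residual conjuncts

Cell `pub-ymgap`, seat `pub-ymgap-dag-n16-a` (KNIT-BY-NAME, HUMAN RULING D-0062; chair R424 venue), generation 3, file 6.  `bears_on: R4∕N16`.  Filed
`--supports stmt-QuantumFields-19182`.  Consumes n16-b g2's F3 `Spine/NE3/PairLeftChartB8` (p418739) BY NAME ([DAGN16B-G2-LANDED-3 + FILED-4] l.≈10700: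
«`endFrame_of_leftChart` :231 is the rep∕skew∕sup∕grad adapter from Thm 4's output letters»).

THE SPLIT.  Files 3–4 take (DICT): at every pair and every unitary `u`, `Concl k α (11d²α) W U′ u → ∃ (u_L, Z), LandauRepB8 L N k W U_A u_L Z s₁ s₂ β ∧
(W·e^{Z})^{u} = U_A^{u₀}` (`U′ = pert (U_A^{u₀}) W`, `u₀ = ptw L W U_A k`).  THIS FILE derives (DICT) from (DICT′): at every pair and every unitary `u`,
`Concl k α (11d²α) W U′ u →` THM 4's OUTPUT IN PRINT's LETTERS — `∃ A` bondwise self-adjoint and `(N·Lᵏ)`-periodic with «`U₁ := U′^{u⁻¹} = e^{iηA}`» read as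
`mgauge W u (cfgExp η A) = U′` (n05-a's `mgauge`∕`cfgExp`, `η = (Lᵏ)⁻¹`), (1.62)∕(1.36) sup letter `‖A‖ ≤ s`, gradient letter `‖∇^η_{W,μ}A_κ‖ ≤ g′`
(`B8Ineq132.covDerivFwd`) — ∧ the RESIDUALS: Thm 4's gauge `u` is `(N·Lᵏ)`-periodic (print: uniqueness + translation covariance), and for the END direction
`Z := fun x μ ↦ Ad (W x μ)⁻¹ (iEta η A x μ)` the three members NOT carried by the left-chart letters — (1.38) `IsLandauB8 L N k W Z` (n16-b's F4∕F5 road: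
`avgKernelGauges = ker Q′_k`, divergence form), the Hölder member and the rough-Laplacian member of `LandauRepB8` ([Balaban1985RegularSpaces] Prop 3 letters).
KERNEL (per pair, §1 `landauRepB8_of_leftChart`): `u_L := u⁻¹·u₀` is unitary and periodic; `Z` is skew (`isSkewDir_AdInv ∘ isSkewDir_iEta`) and periodic
(`isPeriodicDir_AdInv ∘ isPeriodicDir_iEta`); `U_A^{u_L} = W·e^{Z}` and `(W·e^{Z})^{u} = U_A^{u₀}` (`mul_eq_gaugeAct_of_mgauge_eq_pert_gaugeAct`, `gaugeAct_mul`,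
`vary_AdInv_eq_expMul`); `‖Z‖ ≤ η·s ≤ s₁·ξᵏ`; `‖covDiff W μ Z‖ ≤ η²g′ + 2a(ηs) ≤ s₁·ξ²ᵏ` for `a` = the small-field radius of `W` and the k-free line
`g′ + 2(b′ + 226(8(d+1)(d+4))²b′²)·s ≤ s₁` (all four by `endFrame_of_leftChart`).  §2 `dict_of_leftChart`: (DICT′) ∧ (H3ˢᵘᵖ) ∧ letter regime ⟹ (DICT)
(the pair data `W` unitary∕periodic∕small from `RegularSup (k+1) U_B`, `u₀` unitary∕periodic from `B8Eq166ConstraintPair.pinnedTwistedFix_global ∕ ptw_periodic`).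
§3 `pairLandauGaugeB8Avg_of_thm4At_leftChart`: file 4 §1 with (DICT) replaced by (DICT′).  §4 `n16_of_thm4At_leftChart` (`d = 4`): the record knit likewise.

HONEST FRAMING.  Bookkeeping over LANDED theorems by name; (T4) = [Balaban1985RegularSpaces] Thm 4 TYPE at curved backgrounds — NOT proved anywhere; (DICT′)'s
head (Thm 4's output in print letters for the abstract `Concl`) and its residual conjuncts (u-periodicity, (1.38), Hölder, Laplacian) are binders; (H3ˢᵘᵖ) =
N07; **N16 ∕ NE3 is NOT discharged**; count-neutral; one finite four-torus at fixed ε — NOT ℝ⁴, NOT infinite volume, NOT OS, NOT a mass gap, NOT Clay.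
-/

set_option autoImplicit false

open scoped BigOperators Matrix Matrix.Norms.L2Operator
open NormedSpace

namespace Summit.QuantumFields.YangMills.BalabanUVNodes.N16

open Literature.MathematicalPhysics.QuantumFieldTheory.Balaban1983to89
open B7Prop1Explicit B7Prop2Explicit
open T4AveragingDeficitWall (IsUnitaryCfg SmallField Ad IsSkewDir vary)
open T4AveragingDeficitWallBoundary (IsPeriodicCfg)
open B8Lemma1NonAbelian (pert)
open B7Eq92Concrete (mgauge)
open B8Ineq132 (covDerivFwd)
open B8Eq146AExpansion (iEta)
open B8Eq184Proof (cfgExp)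
open B8Eq115GaugeFixing (gaugeAct_mul)
open B8Eq119TwistedAxial (Thm4At Restr129)
open B8Eq166ConstraintPair (ptw ptw_periodic pinnedTwistedFix_global)
open B8Eq133Hypotheses (Reg335Zd)
open B12Ineq417Flat (shiftCfg)
open Summit.QuantumFields.BalabanUV.T4Continuum
open AveragingDeficitPeriodicCounting (IsPeriodicDir)
open MinimalActionSandwich (IsMinimiser)
open MinimalActionRate (Regular sfClass rescale_bavg_mem_sfClass)
open MinimalActionRefine (RegularSup)
open BlockAverageCurrent (curConst curConst_nonneg)
open NE3EnergyShapes (IsUnitarySite IsPeriodicSite)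
open NE3EnergyWeightedCovShape (NE3EnergyRateWCov)
open NE3RightInverseSupLetters (frameC)
open NE3.PairLandauB8 (LandauRepB8 IsLandauB8 covDiff covLapDir)
open NE3.PairLandauB8Avg (PairLandauGaugeB8Avg)
open NE3.LeafIndexSockets (LeafH3sup)
open NE3.RemainderTowerPrepB8 (shiftCfg_of_isPeriodicCfg)
open NE3.SupplierB8SfClassPrep (pdev_le_of_smallField)
open NE3.PairLeftChartB8 (endFrame_of_leftChart mul_eq_gaugeAct_of_mgauge_eq_pert_gaugeAct)

noncomputable section

variable {d : ℕ} {n : Type*} [Fintype n] [DecidableEq n]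

/-! ## §1 Per pair: the Landau representative from the left-chart letters, residuals displayed -/

/-- **THE LANDAU REPRESENTATIVE `(u⁻¹·u₀, Z)` FROM THM 4's OUTPUT IN PRINT's LEFT CHART** (any background data).  `W` unitary, `P`-periodic, small-field of
radius `a ≥ 0`; gauges `u`, `u₀` unitary and `P`-periodic; `A` bondwise self-adjoint and `P`-periodic with `mgauge W u (cfgExp η A) = pert (U_A^{u₀}) W` («`U₁ =
U′^{u⁻¹} = e^{iηA}`»), `‖A‖ ≤ s`, `‖∇^η_{W,μ}A_κ‖ ≤ g′`, `0 < η = ξᵏ` (`ξ = L⁻¹`), letters `s ≤ s₁`, `η²g′ + 2a(ηs) ≤ s₁η²`; `Z := Ad_{W⁻¹}(iηA)`; RESIDUALS as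
hypotheses on that `Z`: (1.38) `IsLandauB8 L N k W Z`, the Hölder member (`s₂`, `β`) and the rough-Laplacian member (`s₁`) of `LandauRepB8`.  THEN
`LandauRepB8 L N k W U_A (u⁻¹·u₀) Z s₁ s₂ β` and `(W·e^{Z})^{u} = U_A^{u₀}` — n16-b's `endFrame_of_leftChart` + bookkeeping. [folklore] -/
theorem landauRepB8_of_leftChart [Nonempty n] {L N k : ℕ} {W UA : Site d → Fin d → (Matrix n n ℂ)ˣ} {P : ℤ} (hPdef : P = ((N * L ^ k : ℕ) : ℤ))
    (hWu : IsUnitaryCfg W) (hWP : IsPeriodicCfg W P) {a : ℝ} (ha : 0 ≤ a) (hWa : SmallField W a)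
    {u u₀ : Site d → (Matrix n n ℂ)ˣ} (hu : ∀ x, u x ∈ unitaryUnits (Matrix n n ℂ)) (huP : IsPeriodicSite u P)
    (hu₀ : ∀ x, u₀ x ∈ unitaryUnits (Matrix n n ℂ)) (hu₀P : IsPeriodicSite u₀ P)
    {η : ℝ} (hη : 0 < η) (hηk : η = ((L : ℝ)⁻¹) ^ k) {A : Site d → Fin d → Matrix n n ℂ}
    (hAsa : ∀ x μ, IsSelfAdjoint (A x μ)) (hAP : ∀ (x : Site d) (κ μ : Fin d), A (x + P • e κ) μ = A x μ)
    (hmg : mgauge W u (cfgExp η A) = pert (gaugeAct u₀ UA) W)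
    {s g' s₁ s₂ β : ℝ} (hs : ∀ x μ, ‖A x μ‖ ≤ s) (hg : ∀ (μ : Fin d) (x : Site d) (κ : Fin d), ‖covDerivFwd η W μ (fun z => A z κ) x‖ ≤ g')
    (hsup : s ≤ s₁) (hgrad : η ^ 2 * g' + 2 * a * (η * s) ≤ s₁ * η ^ 2)
    {Z : Site d → Fin d → Matrix n n ℂ} (hZ : Z = fun x μ => Ad (W x μ)⁻¹ (iEta η A x μ))
    (hlan : IsLandauB8 L N k W Z)
    (hhol : ∀ (κ μ : Fin d) (y : Site d),
      ‖Ad (W (y + e κ) μ) (Ad (W (y + e κ + e μ) μ) (Z (y + (2 : ℕ) • e μ) κ) - Z (y + e μ) κ)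
        - (Ad (W (y + e κ) μ) (Z (y + e μ) κ) - Z y κ)‖ ≤ s₂ * (((L : ℝ)⁻¹) ^ k) ^ ((2 : ℝ) + β))
    (hlap : ∀ (x : Site d) (κ : Fin d), ‖covLapDir W Z x κ‖ ≤ s₁ * (((L : ℝ)⁻¹) ^ k) ^ 3) :
    LandauRepB8 L N k W UA (u⁻¹ * u₀) Z s₁ s₂ β ∧ gaugeAct u (vary W Z 1) = gaugeAct u₀ UA := by
  -- the representation in the END's frame: `cfgExp η A · W = U_A^{u⁻¹ u₀}` bondwise
  have hmul := mul_eq_gaugeAct_of_mgauge_eq_pert_gaugeAct hmg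
  have hrep : ∀ x μ, gaugeAct (u⁻¹ * u₀) UA x μ = cfgExp η A x μ * W x μ := fun x μ => by
    have := congrFun (congrFun hmul x) μ
    simpa only [Pi.mul_apply] using this.symm
  obtain ⟨hrepZ, hskew, hsupZ, hgradZ⟩ := endFrame_of_leftChart hWu ha hWa hη hAsa hrep hs hg
  subst hZ
  have hξk : 0 ≤ ((L : ℝ)⁻¹) ^ k := pow_nonneg (inv_nonneg.mpr (Nat.cast_nonneg L)) k
  refine ⟨{ unitary := fun x => (unitaryUnits _).mul_mem ((unitaryUnits _).inv_mem (hu x)) (hu₀ x)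
            periodic := fun x i => ?_
            skew := hskew
            per := ?_
            rep := hrepZ
            landau := hlan
            sup := fun x κ => ?_
            grad := fun κ x μ => ?_
            holder := hhol
            lap := hlap }, ?_⟩
  · -- periodicity of `u⁻¹ · u₀`
    rw [hPdef] at huP hu₀P
    simp only [Pi.mul_apply, Pi.inv_apply, huP x i, hu₀P x i]
  · -- periodicity of `Z`
    rw [hPdef] at hWP hAP
    exact NE3.PairLeftChartB8.isPeriodicDir_AdInv hWP (NE3.PairLeftChartB8.isPeriodicDir_iEta η hAP)
  · -- sup: `‖Z‖ ≤ η s ≤ s₁ ξᵏ`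
    calc ‖Ad (W x κ)⁻¹ (iEta η A x κ)‖ ≤ η * s := hsupZ x κ
      _ ≤ s₁ * ((L : ℝ)⁻¹) ^ k := by rw [hηk, mul_comm]; exact mul_le_mul_of_nonneg_right hsup hξk
  · -- grad: `‖covDiff‖ ≤ η²g′ + 2a(ηs) ≤ s₁ ξ²ᵏ`
    have h := hgradZ κ x μ
    have e : covDiff W μ (fun x μ => Ad (W x μ)⁻¹ (iEta η A x μ)) x κ
        = Ad (W (x + e κ) μ) (Ad (W (x + e μ) κ)⁻¹ (iEta η A (x + e μ) κ)) - Ad (W x κ)⁻¹ (iEta η A x κ) := rfl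
    rw [e] at h
    calc _ ≤ η ^ 2 * g' + 2 * a * (η * s) := h
      _ ≤ s₁ * η ^ 2 := hgrad
      _ = s₁ * (((L : ℝ)⁻¹) ^ k) ^ 2 := by rw [hηk]
  · -- the transition-gauge equation `(W·e^{Z})^{u} = U_A^{u₀}`
    rw [← hrepZ, ← gaugeAct_mul]
    simp only [mul_inv_cancel_left]

/-! ## §2 At the NE3 pair: (DICT′) ∧ (H3ˢᵘᵖ) ⟹ (DICT) -/

/-- **THE CONCL-DICTIONARY (DICT) OF FILES 3–4 FROM ITS LEFT-CHART FORM (DICT′)** (`d ≥ 1`, `L ≥ 2`; class radius `ε ≥ 0`; sup letters `(b′, c′)` with (Rb);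
letter `α > ε` with `b′ + 226(8(d+1)(d+4))²b′² < α`, `C₀α ≤ ⅓`, `2α ≤ c₂′`; left-chart letters `0 ≤ s ≤ s₁`, `g′` with the k-free line
`g′ + 2(b′ + 226(8(d+1)(d+4))²b′²)·s ≤ s₁`).  (DICT′): at every pair and every unitary `u`, `Concl k α (11d²α) W U′ u` yields Thm 4's output in print's
left-chart letters at `η = (Lᵏ)⁻¹` — `∃ A` self-adjoint, `(N·Lᵏ)`-periodic, `mgauge W u (cfgExp η A) = U′`, `‖A‖ ≤ s`, `‖∇^η_{W,μ}A_κ‖ ≤ g′` — together with the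
RESIDUALS: `u` is `(N·Lᵏ)`-periodic, and (1.38), the Hölder member, the Laplacian member hold for `Z = Ad_{W⁻¹}(iηA)`.  With (H3ˢᵘᵖ) (so `W` is unitary,
periodic, small-field and `u₀ = ptw L W U_A k` unitary, periodic): (DICT) — `∃ (u_L, Z), LandauRepB8 L N k W U_A u_L Z s₁ s₂ β ∧ (W·e^{Z})^{u} = U_A^{u₀}`.
§1 at the pair. [folklore] -/
theorem dict_of_leftChart [Nonempty n] (hd : 1 ≤ d) {L N : ℕ} (hL : 2 ≤ L) {ε b' c' α s g' s₁ s₂ β : ℝ}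
    (hε : 0 ≤ ε) (hb' : 0 ≤ b') (hRb : 2 ^ 15 * ((d : ℝ) + 1) ^ 2 * ((d : ℝ) + 4) ^ 2 * (L : ℝ) ^ 2 * b' ≤ 1)
    (hα : 0 < α) (hεα : ε < α) (hb'α : b' + 226 * (8 * (d + 1) * (d + 4)) ^ 2 * b' ^ 2 < α) (hα3 : C0 d * α ≤ 1 / 3) (hα2 : 2 * α ≤ c2' d L)
    (hs0 : 0 ≤ s) (hsup : s ≤ s₁) (hgrad : g' + 2 * (b' + 226 * (8 * (d + 1) * (d + 4)) ^ 2 * b' ^ 2) * s ≤ s₁)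
    {Concl : ℕ → ℝ → ℝ → (Site d → Fin d → (Matrix n n ℂ)ˣ) → (Site d → Fin d → (Matrix n n ℂ)ˣ) → (Site d → (Matrix n n ℂ)ˣ) → Prop}
    {dom : Set (Site d → Fin d → (Matrix n n ℂ)ˣ)}
    (hdict' : ∀ k : ℕ, 1 ≤ k → ∀ V ∈ dom, ∀ UA UB : Site d → Fin d → (Matrix n n ℂ)ˣ,
      IsMinimiser d (sfClass d L N ε) L N k V UA → IsMinimiser d (sfClass d L N ε) L N (k + 1) V UB →
      ∀ u : Site d → (Matrix n n ℂ)ˣ, (∀ x, u x ∈ unitaryUnits (Matrix n n ℂ)) →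
        Concl k α (11 * (d : ℝ) ^ 2 * α) (rescale L (bavg L UB))
          (pert (gaugeAct (ptw L (rescale L (bavg L UB)) UA k) UA) (rescale L (bavg L UB))) u →
        ∃ A : Site d → Fin d → Matrix n n ℂ,
          (∀ x μ, IsSelfAdjoint (A x μ)) ∧ (∀ (x : Site d) (κ μ : Fin d), A (x + ((N * L ^ k : ℕ) : ℤ) • e κ) μ = A x μ) ∧
          mgauge (rescale L (bavg L UB)) u (cfgExp (((L : ℝ) ^ k)⁻¹) A)
            = pert (gaugeAct (ptw L (rescale L (bavg L UB)) UA k) UA) (rescale L (bavg L UB)) ∧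
          (∀ x μ, ‖A x μ‖ ≤ s) ∧
          (∀ (μ : Fin d) (x : Site d) (κ : Fin d), ‖covDerivFwd (((L : ℝ) ^ k)⁻¹) (rescale L (bavg L UB)) μ (fun z => A z κ) x‖ ≤ g') ∧
          IsPeriodicSite u ((N * L ^ k : ℕ) : ℤ) ∧
          IsLandauB8 L N k (rescale L (bavg L UB)) (fun x μ => Ad (rescale L (bavg L UB) x μ)⁻¹ (iEta (((L : ℝ) ^ k)⁻¹) A x μ)) ∧
          (∀ (κ μ : Fin d) (y : Site d),
            ‖Ad (rescale L (bavg L UB) (y + e κ) μ)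
                (Ad (rescale L (bavg L UB) (y + e κ + e μ) μ)
                    ((fun x μ => Ad (rescale L (bavg L UB) x μ)⁻¹ (iEta (((L : ℝ) ^ k)⁻¹) A x μ)) (y + (2 : ℕ) • e μ) κ)
                  - (fun x μ => Ad (rescale L (bavg L UB) x μ)⁻¹ (iEta (((L : ℝ) ^ k)⁻¹) A x μ)) (y + e μ) κ)
              - (Ad (rescale L (bavg L UB) (y + e κ) μ) ((fun x μ => Ad (rescale L (bavg L UB) x μ)⁻¹ (iEta (((L : ℝ) ^ k)⁻¹) A x μ)) (y + e μ) κ)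
                - (fun x μ => Ad (rescale L (bavg L UB) x μ)⁻¹ (iEta (((L : ℝ) ^ k)⁻¹) A x μ)) y κ)‖
              ≤ s₂ * (((L : ℝ)⁻¹) ^ k) ^ ((2 : ℝ) + β)) ∧
          (∀ (x : Site d) (κ : Fin d),
            ‖covLapDir (rescale L (bavg L UB)) (fun x μ => Ad (rescale L (bavg L UB) x μ)⁻¹ (iEta (((L : ℝ) ^ k)⁻¹) A x μ)) x κ‖
              ≤ s₁ * (((L : ℝ)⁻¹) ^ k) ^ 3))
    (h3 : LeafH3sup d L N ε b' c' dom) :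
    ∀ k : ℕ, 1 ≤ k → ∀ V ∈ dom, ∀ UA UB : Site d → Fin d → (Matrix n n ℂ)ˣ,
      IsMinimiser d (sfClass d L N ε) L N k V UA → IsMinimiser d (sfClass d L N ε) L N (k + 1) V UB →
      ∀ u : Site d → (Matrix n n ℂ)ˣ, (∀ x, u x ∈ unitaryUnits (Matrix n n ℂ)) →
        Concl k α (11 * (d : ℝ) ^ 2 * α) (rescale L (bavg L UB))
          (pert (gaugeAct (ptw L (rescale L (bavg L UB)) UA k) UA) (rescale L (bavg L UB))) u →
        ∃ (uL : Site d → (Matrix n n ℂ)ˣ) (Z : Site d → Fin d → Matrix n n ℂ),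
          LandauRepB8 L N k (rescale L (bavg L UB)) UA uL Z s₁ s₂ β ∧
          gaugeAct u (vary (rescale L (bavg L UB)) Z 1) = gaugeAct (ptw L (rescale L (bavg L UB)) UA k) UA := by
  intro k hk V hV UA UB hA hB u hu hconcl
  letI : CStarAlgebra (Matrix n n ℂ) := {}
  have hL1 : 1 ≤ L := le_trans (by norm_num) hL
  have hL1r : (1 : ℝ) ≤ L := by exact_mod_cast hL1
  have hLk : (1 : ℝ) ≤ (L : ℝ) ^ k := one_le_pow₀ hL1r
  have hLk0 : (0 : ℝ) < (L : ℝ) ^ k := by positivity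
  obtain ⟨A, hAsa, hAP, hmg, hs, hg, huP, hlan, hhol, hlap⟩ := hdict' k hk V hV UA UB hA hB u hu hconcl
  set W : Site d → Fin d → (Matrix n n ℂ)ˣ := rescale L (bavg L UB) with hWdef
  set αW : ℝ := b' + 226 * (8 * (d + 1) * (d + 4)) ^ 2 * b' ^ 2 with hαWdef
  have hαW0 : 0 ≤ αW := by rw [hαWdef]; positivity
  -- the pair's background: unitary, periodic, small-field (from (H3ˢᵘᵖ) at `U_B`)
  have hregB : RegularSup d L N b' c' (k + 1) UB := h3 V hV k UB hB
  have hbs' : 512 * (d + 1) * (d + 4) * (L : ℝ) ^ 2 * b' ≤ 1 := by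
    have h1 : (512 : ℝ) * (d + 1) * (d + 4) * (L : ℝ) ^ 2 * b' ≤ 2 ^ 15 * ((d : ℝ) + 1) ^ 2 * ((d : ℝ) + 4) ^ 2 * (L : ℝ) ^ 2 * b' := by
      have hd0 : (0 : ℝ) ≤ d := Nat.cast_nonneg d
      have : (512 : ℝ) * (d + 1) * (d + 4) ≤ 2 ^ 15 * ((d : ℝ) + 1) ^ 2 * ((d : ℝ) + 4) ^ 2 := by nlinarith
      have hL2b : 0 ≤ (L : ℝ) ^ 2 * b' := by positivity
      nlinarith
    linarith
  have hWcl : W ∈ sfClass d L N αW k := rescale_bavg_mem_sfClass hL1 hb' hbs' le_rfl hregB.regular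
  obtain ⟨hWu, hWP, hWsm⟩ := hWcl
  -- the run-A minimiser's class data and the pinned axial pre-gauge `u₀ = ptw L W U_A k`: unitary, periodic
  obtain ⟨hAu, hAuP, hAsm⟩ := hA.mem.1
  have hG := avgClosed_unitaryUnits d (𝔸 := Matrix n n ℂ) L
  have h34 : pdev UA < α * (((L : ℝ) ^ k)⁻¹) ^ 2 := by
    refine (pdev_le_of_smallField (div_nonneg hε (by positivity)) hAsm).trans_lt ?_
    rw [inv_pow, ← div_eq_mul_inv]; exact div_lt_div_of_pos_right hεα (by positivity)
  have h33 : pdev W < α * (((L : ℝ) ^ k)⁻¹) ^ 2 := by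
    refine (pdev_le_of_smallField (div_nonneg hαW0 (by positivity)) hWsm).trans_lt ?_
    rw [inv_pow, ← div_eq_mul_inv]; exact div_lt_div_of_pos_right hb'α (by positivity)
  obtain ⟨hu₀G, -, -, -, -, -⟩ := pinnedTwistedFix_global L hL hG k W UA hWu hAu hα hα3 hα2 h33 h34
  have hAshift : ∀ i : Fin d, shiftCfg (((N * L ^ k : ℕ) : ℤ) • e i) UA = UA := fun i => shiftCfg_of_isPeriodicCfg hAuP (e i)
  have hWshift : ∀ i : Fin d, shiftCfg (((N * L ^ k : ℕ) : ℤ) • e i) W = W := fun i => shiftCfg_of_isPeriodicCfg hWP (e i)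
  have hu₀P : IsPeriodicSite (ptw L W UA k) ((N * L ^ k : ℕ) : ℤ) := fun x i => ptw_periodic hL1 N k hWshift hAshift x i
  -- the letters at `η = (Lᵏ)⁻¹`
  have hη : (0 : ℝ) < ((L : ℝ) ^ k)⁻¹ := by positivity
  have hηk : ((L : ℝ) ^ k)⁻¹ = ((L : ℝ)⁻¹) ^ k := (inv_pow _ _).symm
  have hη1 : ((L : ℝ) ^ k)⁻¹ ≤ 1 := inv_le_one_of_one_le₀ hLk
  have hgrad' : (((L : ℝ) ^ k)⁻¹) ^ 2 * g' + 2 * (αW / ((L : ℝ) ^ k) ^ 2) * ((((L : ℝ) ^ k)⁻¹) * s) ≤ s₁ * (((L : ℝ) ^ k)⁻¹) ^ 2 := by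
    have e : (((L : ℝ) ^ k)⁻¹) ^ 2 * g' + 2 * (αW / ((L : ℝ) ^ k) ^ 2) * ((((L : ℝ) ^ k)⁻¹) * s)
        = (((L : ℝ) ^ k)⁻¹) ^ 2 * (g' + 2 * αW * s * ((L : ℝ) ^ k)⁻¹) := by
      field_simp
    rw [e, mul_comm s₁]
    refine mul_le_mul_of_nonneg_left ?_ (by positivity)
    have h1 : 2 * αW * s * ((L : ℝ) ^ k)⁻¹ ≤ 2 * αW * s := mul_le_of_le_one_right (by positivity) hη1
    linarith
  exact ⟨u⁻¹ * ptw L W UA k, _, landauRepB8_of_leftChart rfl hWu hWP (div_nonneg hαW0 (by positivity)) hWsm hu huP hu₀G hu₀P hη hηk hAsa hAP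
    hmg hs hg hsup hgrad' rfl hlan hhol hlap⟩

/-! ## §3 The assembly with the Concl-dictionary in left-chart form -/

/-- **`PairLandauGaugeB8Avg` FROM [B8] THM 4's TYPED INTERFACE (`Reg := Reg335Zd`), THE LEFT-CHART FORM (DICT′) OF ITS CONCL-DICTIONARY, AND N07's
INTERFACE** (`d ≥ 1`, `L ≥ 2`): file 4's `pairLandauGaugeB8Avg_of_thm4At_reg335` with (DICT) supplied by §2 — the N05-side binders are now (T4) and (DICT′),
whose residual conjuncts (u-periodicity, (1.38), Hölder, Laplacian) are displayed. [folklore] -/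
theorem pairLandauGaugeB8Avg_of_thm4At_leftChart [Nonempty n] (hd : 1 ≤ d) {L N : ℕ} (hL : 2 ≤ L) {ε b g b' c' α c₁ s g' s₁ s₂ β : ℝ}
    (hε : 0 ≤ ε) (hb : 0 ≤ b) (hbs : 512 * (d + 1) * (d + 4) * (L : ℝ) ^ 2 * b ≤ 1)
    (hbα : b + 226 * (8 * (d + 1) * (d + 4)) ^ 2 * b ^ 2 < α)
    (hb' : 0 ≤ b') (hc' : 0 ≤ c') (hb'1 : b' ≤ 1) (hRb : 2 ^ 15 * ((d : ℝ) + 1) ^ 2 * ((d : ℝ) + 4) ^ 2 * (L : ℝ) ^ 2 * b' ≤ 1)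
    (hb'α : b' + 226 * (8 * (d + 1) * (d + 4)) ^ 2 * b' ^ 2 < α) (hc'α : 4 * ((d : ℝ) - 1) * (c' + curConst d L * b' ^ 2) < α)
    (hα : 0 < α) (hεα : ε < α) (hα3 : C0 d * α ≤ 1 / 3) (hα2 : 2 * α ≤ c2' d L) (hsmall : 11 * (d : ℝ) ^ 2 * α ≤ 1 / 6)
    (hc₁ : α + 11 * (d : ℝ) ^ 2 * α ≤ c₁)
    {Mc : ℝ} (hMc : 0 ≤ Mc) (hMcα : (Mc + 1) * (b' + 226 * (8 * (d + 1) * (d + 4)) ^ 2 * b' ^ 2) ≤ 1 / 2)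
    {𝒬 : ℕ → Set (Set (Site d) × ℕ)}
    (h𝒬 : ∀ k, ∀ q ∈ 𝒬 k, q.2 ≤ k ∧ ∃ y : Site d, ∀ z ∈ q.1, (l1 (z - y) : ℝ) ≤ Mc * (L : ℝ) ^ q.2)
    {C : ℝ} (hC : 2 * (Mc + 1) * (b' + 226 * (8 * (d + 1) * (d + 4)) ^ 2 * b' ^ 2) + 2 * Mc * (2 * (c' + curConst d L * b' ^ 2)) +
      4 * Mc * (1 + 2 * Mc) * (b' + 226 * (8 * (d + 1) * (d + 4)) ^ 2 * b' ^ 2) ^ 2 < C)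
    (hs0 : 0 ≤ s) (hsup : s ≤ s₁) (hgrad : g' + 2 * (b' + 226 * (8 * (d + 1) * (d + 4)) ^ 2 * b' ^ 2) * s ≤ s₁)
    {a : ℕ → Site d} {M ρ : ℕ → ℕ} {Λ : ℕ → ℕ → Set (Site d)}
    {Concl : ℕ → ℝ → ℝ → (Site d → Fin d → (Matrix n n ℂ)ˣ) → (Site d → Fin d → (Matrix n n ℂ)ˣ) → (Site d → (Matrix n n ℂ)ˣ) → Prop}
    (hΛ : ∀ k, Λ k k = Set.univ)
    (hT4 : ∀ k, 1 ≤ k → Thm4At L k (((L : ℝ) ^ k)⁻¹) c₁ (unitaryUnits (Matrix n n ℂ)) (a k) (M k) (ρ k)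
      (Reg335Zd (((L : ℝ) ^ k)⁻¹) L (𝒬 k) C) (Restr129 L k (Λ k)) (Concl k))
    {dom : Set (Site d → Fin d → (Matrix n n ℂ)ˣ)}
    (hdict' : (∀ k : ℕ, 1 ≤ k → ∀ V ∈ dom, ∀ UA UB : Site d → Fin d → (Matrix n n ℂ)ˣ,
      IsMinimiser d (sfClass d L N ε) L N k V UA → IsMinimiser d (sfClass d L N ε) L N (k + 1) V UB →
      ∀ u : Site d → (Matrix n n ℂ)ˣ, (∀ x, u x ∈ unitaryUnits (Matrix n n ℂ)) →
        Concl k α (11 * (d : ℝ) ^ 2 * α) (rescale L (bavg L UB))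
          (pert (gaugeAct (ptw L (rescale L (bavg L UB)) UA k) UA) (rescale L (bavg L UB))) u →
        ∃ A : Site d → Fin d → Matrix n n ℂ,
          (∀ x μ, IsSelfAdjoint (A x μ)) ∧ (∀ (x : Site d) (κ μ : Fin d), A (x + ((N * L ^ k : ℕ) : ℤ) • e κ) μ = A x μ) ∧
          mgauge (rescale L (bavg L UB)) u (cfgExp (((L : ℝ) ^ k)⁻¹) A)
            = pert (gaugeAct (ptw L (rescale L (bavg L UB)) UA k) UA) (rescale L (bavg L UB)) ∧
          (∀ x μ, ‖A x μ‖ ≤ s) ∧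
          (∀ (μ : Fin d) (x : Site d) (κ : Fin d), ‖covDerivFwd (((L : ℝ) ^ k)⁻¹) (rescale L (bavg L UB)) μ (fun z => A z κ) x‖ ≤ g') ∧
          IsPeriodicSite u ((N * L ^ k : ℕ) : ℤ) ∧
          IsLandauB8 L N k (rescale L (bavg L UB)) (fun x μ => Ad (rescale L (bavg L UB) x μ)⁻¹ (iEta (((L : ℝ) ^ k)⁻¹) A x μ)) ∧
          (∀ (κ μ : Fin d) (y : Site d),
            ‖Ad (rescale L (bavg L UB) (y + e κ) μ)
                (Ad (rescale L (bavg L UB) (y + e κ + e μ) μ)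
                    ((fun x μ => Ad (rescale L (bavg L UB) x μ)⁻¹ (iEta (((L : ℝ) ^ k)⁻¹) A x μ)) (y + (2 : ℕ) • e μ) κ)
                  - (fun x μ => Ad (rescale L (bavg L UB) x μ)⁻¹ (iEta (((L : ℝ) ^ k)⁻¹) A x μ)) (y + e μ) κ)
              - (Ad (rescale L (bavg L UB) (y + e κ) μ) ((fun x μ => Ad (rescale L (bavg L UB) x μ)⁻¹ (iEta (((L : ℝ) ^ k)⁻¹) A x μ)) (y + e μ) κ)
                - (fun x μ => Ad (rescale L (bavg L UB) x μ)⁻¹ (iEta (((L : ℝ) ^ k)⁻¹) A x μ)) y κ)‖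
              ≤ s₂ * (((L : ℝ)⁻¹) ^ k) ^ ((2 : ℝ) + β)) ∧
          (∀ (x : Site d) (κ : Fin d),
            ‖covLapDir (rescale L (bavg L UB)) (fun x μ => Ad (rescale L (bavg L UB) x μ)⁻¹ (iEta (((L : ℝ) ^ k)⁻¹) A x μ)) x κ‖
              ≤ s₁ * (((L : ℝ)⁻¹) ^ k) ^ 3)))
    (h3 : LeafH3sup d L N ε b' c' dom) :
    PairLandauGaugeB8Avg d (sfClass d L N ε) L N b g s₁ s₂ β dom :=
  pairLandauGaugeB8Avg_of_thm4At_reg335 hd hL hε hb hbs hbα hb' hc' hb'1 hRb hb'α hc'α hα hεα hα3 hα2 hsmall hc₁ hMc hMcα h𝒬 hC hΛ hT4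
    (dict_of_leftChart hd hL hε hb' hRb hα hεα hb'α hα3 hα2 hs0 hsup hgrad hdict' h3) h3

/-! ## §4 The `d = 4` record knit with the Concl-dictionary in left-chart form -/

/-- **N16 · NE3 BY NAME FROM [B8] THM 4's TYPED INTERFACE (`Reg := Reg335Zd`), ITS CONCL-DICTIONARY IN LEFT-CHART FORM (DICT′), AND N07's INTERFACE**
(`d = 4`; `L ≥ 2`, `N ≥ 1`; Thm 4's constant `c₁ > 0`; `α⋆ = min {1∕(3C₀(4)), c₂′(4,L)∕2, 1∕1056, c₁∕177}`): file 4's `n16_of_thm4At_reg335` with (DICT) replaced by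
(DICT′) at sup letter `s₁` and gradient letter `g′` with ONE more ε-free line `g′ + 2(b′ + 226·320²·b′²)·s₁ ≤ s₁`.  After this file the N05 side of N16's knit
reads: (T4) `Thm4At` at the pair backgrounds + Thm 4's output in PRINT's left-chart letters + the residuals (u-periodicity, (1.38), Hölder, Laplacian).
N16 ∕ NE3 NOT proved. [folklore] -/
theorem n16_of_thm4At_leftChart [Nonempty n] {L N : ℕ} (hL : 2 ≤ L) (hN : 1 ≤ N) {c₁ : ℝ} (hc₁ : 0 < c₁) :
    ∃ r : ℝ, 0 < r ∧ ∀ ⦃g : ℝ⦄, 0 < g → ∃ C : ℝ, 0 ≤ C ∧ ∀ ⦃b' c' : ℝ⦄, 0 ≤ b' → 0 ≤ c' →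
      2 ^ 15 * ((4 : ℝ) + 1) ^ 2 * ((4 : ℝ) + 4) ^ 2 * (L : ℝ) ^ 2 * b' ≤ 1 →
      23040 * (4 : ℝ) ^ 4 * (frameC 4 L + 4) ^ 3 * (c' + curConst 4 L * b' ^ 2) ≤ 1 →
      b' + 226 * (8 * ((4 : ℝ) + 1) * ((4 : ℝ) + 4)) ^ 2 * b' ^ 2 < min (1 / (3 * C0 4)) (min (c2' 4 L / 2) (min (1 / 1056) (c₁ / 177))) →
      4 * ((4 : ℝ) - 1) * (c' + curConst 4 L * b' ^ 2) < min (1 / (3 * C0 4)) (min (c2' 4 L / 2) (min (1 / 1056) (c₁ / 177))) →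
      ∀ ⦃Mc : ℝ⦄, 0 ≤ Mc → (Mc + 1) * (b' + 226 * (8 * ((4 : ℝ) + 1) * ((4 : ℝ) + 4)) ^ 2 * b' ^ 2) ≤ 1 / 2 →
      ∀ (𝒬 : ℕ → Set (Set (Site 4) × ℕ)), (∀ k, ∀ q ∈ 𝒬 k, q.2 ≤ k ∧ ∃ y : Site 4, ∀ z ∈ q.1, (l1 (z - y) : ℝ) ≤ Mc * (L : ℝ) ^ q.2) →
      ∀ ⦃C335 : ℝ⦄, 2 * (Mc + 1) * (b' + 226 * (8 * ((4 : ℝ) + 1) * ((4 : ℝ) + 4)) ^ 2 * b' ^ 2) + 2 * Mc * (2 * (c' + curConst 4 L * b' ^ 2)) +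
        4 * Mc * (1 + 2 * Mc) * (b' + 226 * (8 * ((4 : ℝ) + 1) * ((4 : ℝ) + 4)) ^ 2 * b' ^ 2) ^ 2 < C335 →
      ∀ ⦃ε s₁ b : ℝ⦄, 0 < ε → ε ≤ r → 0 ≤ s₁ → s₁ ≤ r → 0 ≤ b → b ≤ ε / 2 →
      ∀ ⦃g' : ℝ⦄, g' + 2 * (b' + 226 * (8 * ((4 : ℝ) + 1) * ((4 : ℝ) + 4)) ^ 2 * b' ^ 2) * s₁ ≤ s₁ → ∀ (s₂ : ℝ)
      (a : ℕ → Site 4) (M ρ : ℕ → ℕ) (Λ : ℕ → ℕ → Set (Site 4))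
      (Concl : ℕ → ℝ → ℝ → (Site 4 → Fin 4 → (Matrix n n ℂ)ˣ) → (Site 4 → Fin 4 → (Matrix n n ℂ)ˣ) → (Site 4 → (Matrix n n ℂ)ˣ) → Prop),
      (∀ k, Λ k k = Set.univ) →
      (∀ k, 1 ≤ k → Thm4At L k (((L : ℝ) ^ k)⁻¹) c₁ (unitaryUnits (Matrix n n ℂ)) (a k) (M k) (ρ k)
        (Reg335Zd (((L : ℝ) ^ k)⁻¹) L (𝒬 k) C335) (Restr129 L k (Λ k)) (Concl k)) →
      ∀ {dom : _root_.Set (Site 4 → Fin 4 → (Matrix n n ℂ)ˣ)},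
        (∀ k : ℕ, 1 ≤ k → ∀ V ∈ dom, ∀ UA UB : Site 4 → Fin 4 → (Matrix n n ℂ)ˣ,
      IsMinimiser 4 (sfClass 4 L N ε) L N k V UA → IsMinimiser 4 (sfClass 4 L N ε) L N (k + 1) V UB →
      ∀ u : Site 4 → (Matrix n n ℂ)ˣ, (∀ x, u x ∈ unitaryUnits (Matrix n n ℂ)) →
        Concl k (min (1 / (3 * C0 4)) (min (c2' 4 L / 2) (min (1 / 1056) (c₁ / 177)))) (11 * ((4 : ℕ) : ℝ) ^ 2 * (min (1 / (3 * C0 4)) (min (c2' 4 L / 2) (min (1 / 1056) (c₁ / 177))))) (rescale L (bavg L UB))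
          (pert (gaugeAct (ptw L (rescale L (bavg L UB)) UA k) UA) (rescale L (bavg L UB))) u →
        ∃ A : Site 4 → Fin 4 → Matrix n n ℂ,
          (∀ x μ, IsSelfAdjoint (A x μ)) ∧ (∀ (x : Site 4) (κ μ : Fin 4), A (x + ((N * L ^ k : ℕ) : ℤ) • e κ) μ = A x μ) ∧
          mgauge (rescale L (bavg L UB)) u (cfgExp (((L : ℝ) ^ k)⁻¹) A)
            = pert (gaugeAct (ptw L (rescale L (bavg L UB)) UA k) UA) (rescale L (bavg L UB)) ∧
          (∀ x μ, ‖A x μ‖ ≤ s₁) ∧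
          (∀ (μ : Fin 4) (x : Site 4) (κ : Fin 4), ‖covDerivFwd (((L : ℝ) ^ k)⁻¹) (rescale L (bavg L UB)) μ (fun z => A z κ) x‖ ≤ g') ∧
          IsPeriodicSite u ((N * L ^ k : ℕ) : ℤ) ∧
          IsLandauB8 L N k (rescale L (bavg L UB)) (fun x μ => Ad (rescale L (bavg L UB) x μ)⁻¹ (iEta (((L : ℝ) ^ k)⁻¹) A x μ)) ∧
          (∀ (κ μ : Fin 4) (y : Site 4),
            ‖Ad (rescale L (bavg L UB) (y + e κ) μ)
                (Ad (rescale L (bavg L UB) (y + e κ + e μ) μ)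
                    ((fun x μ => Ad (rescale L (bavg L UB) x μ)⁻¹ (iEta (((L : ℝ) ^ k)⁻¹) A x μ)) (y + (2 : ℕ) • e μ) κ)
                  - (fun x μ => Ad (rescale L (bavg L UB) x μ)⁻¹ (iEta (((L : ℝ) ^ k)⁻¹) A x μ)) (y + e μ) κ)
              - (Ad (rescale L (bavg L UB) (y + e κ) μ) ((fun x μ => Ad (rescale L (bavg L UB) x μ)⁻¹ (iEta (((L : ℝ) ^ k)⁻¹) A x μ)) (y + e μ) κ)
                - (fun x μ => Ad (rescale L (bavg L UB) x μ)⁻¹ (iEta (((L : ℝ) ^ k)⁻¹) A x μ)) y κ)‖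
              ≤ s₂ * (((L : ℝ)⁻¹) ^ k) ^ ((2 : ℝ) + (1 : ℝ))) ∧
          (∀ (x : Site 4) (κ : Fin 4),
            ‖covLapDir (rescale L (bavg L UB)) (fun x μ => Ad (rescale L (bavg L UB) x μ)⁻¹ (iEta (((L : ℝ) ^ k)⁻¹) A x μ)) x κ‖
              ≤ s₁ * (((L : ℝ)⁻¹) ^ k) ^ 3)) →
        LeafH3sup 4 L N ε b' c' dom →
        NE3EnergyRateWCov 4 (sfClass 4 L N ε) L N b g C s₁ s₂ dom := by
  have hL1 : 1 ≤ L := by omega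
  obtain ⟨r, hr0, hr⟩ := n16_of_thm4At_reg335 (n := n) hL hN hc₁
  set α : ℝ := min (1 / (3 * C0 4)) (min (c2' 4 L / 2) (min (1 / 1056) (c₁ / 177))) with hαdef
  have hC0 : 0 < C0 4 := C0_pos 4
  have hc2 : 0 < c2' 4 L := c2'_pos 4 L hL1
  have hα0 : 0 < α := lt_min (by positivity) (lt_min (by positivity) (lt_min (by norm_num) (by positivity)))
  have hα1 : α ≤ 1 / (3 * C0 4) := min_le_left _ _
  have hα2' : α ≤ c2' 4 L / 2 := (min_le_right _ _).trans (min_le_left _ _)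
  refine ⟨min r (α / 2), lt_min hr0 (by positivity), fun g hg => ?_⟩
  obtain ⟨C, hC0', hC⟩ := hr hg
  refine ⟨C, hC0', fun b' c' hb' hc' hRb hcF hb'α hc'α Mc hMc hMcα 𝒬 h𝒬 C335 hC335 ε s₁ b hε hεr hs₁ hs₁r hb hbh g' hgrad s₂ a M ρ Λ Concl hΛ hT4 dom
    hdict' h3 => ?_⟩
  have hεr' : ε ≤ r := hεr.trans (min_le_left _ _)
  have hεα : ε < α := by have := hεr.trans (min_le_right _ _); linarith
  have hs₁r' : s₁ ≤ r := hs₁r.trans (min_le_left _ _)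
  have hA3 : C0 4 * α ≤ 1 / 3 := by
    rw [le_div_iff₀ (by positivity)] at hα1; linarith
  have hA2 : 2 * α ≤ c2' 4 L := by linarith
  have hRb' : 2 ^ 15 * ((((4 : ℕ) : ℝ)) + 1) ^ 2 * ((((4 : ℕ) : ℝ)) + 4) ^ 2 * (L : ℝ) ^ 2 * b' ≤ 1 := by simpa only [Nat.cast_ofNat] using hRb
  have hb'α' : b' + 226 * (8 * ((4 : ℕ) + 1 : ℝ) * ((4 : ℕ) + 4 : ℝ)) ^ 2 * b' ^ 2 < α := by simpa using hb'α
  have hgrad' : g' + 2 * (b' + 226 * (8 * ((4 : ℕ) + 1 : ℝ) * ((4 : ℕ) + 4 : ℝ)) ^ 2 * b' ^ 2) * s₁ ≤ s₁ := by simpa using hgrad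
  exact hC hb' hc' hRb hcF hb'α hc'α hMc hMcα 𝒬 h𝒬 hC335 hε hεr' hs₁ hs₁r' hb hbh s₂ a M ρ Λ Concl hΛ hT4
    (dict_of_leftChart (by norm_num) hL hε.le hb' hRb' hα0 hεα hb'α' hA3 hA2 hs₁ le_rfl hgrad' hdict' h3) h3

end

end Summit.QuantumFields.YangMills.BalabanUVNodes.N16
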